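import Summits.BirchSwinnertonDyer.Rank1Residual.X11b.LocalH2Vanishing
import Summits.BirchSwinnertonDyer.Rank1Residual.X11b.LocalH2TransitionCd
import Summits.BirchSwinnertonDyer.Rank1Residual.X11b.GlobalH2FiniteSupport
import Summits.BirchSwinnertonDyer.Rank1Residual.X11b.ShaTwoLevelBound
import Summits.BirchSwinnertonDyer.Rank1Residual.X11b.AnticyclotomicInfinitePlaces
import Literature.NumberTheory.GaloisRepresentations.NumberFieldCdTwo
import Mathlib.NumberTheory.NumberField.InfinitePlace.TotallyRealComplex
import HarnessLib

/-!
# X11b, route R1 — WEAK LEOPOLDT for `E[p^∞]` over a totally complex number field: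
# `H²(Γ_K, E[p^∞]) = 0` from the finiteness of Castella's Selmer group `Sel_𝔭(K, E[p^∞])`

HONEST FRAMING (cell `b2b-bsdres`, run/shared/lean/b2b/bsd-rank1-residual/, verbatim in every
file): the goal of the cell is to DELETE the COMBINATION-SHAPED residual classes of the
Birch–Swinnerton-Dyer formula for ALL analytic-rank `≤ 1` elliptic curves over `ℚ` — "full BSD
formula for every rank `≤ 1` curve in class `C`" assembled STRICTLY from published theorems — so
that the rank-`≤ 1` remainder becomes exactly the CONSTRUCTION-SHAPED classes, which are TYPED
(missing-input `Prop`s), NOT attempted. This is not "finishing BSD". Sub-cell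
`b2b-bsdres-multr1-p1` (X11b, route R1 = Castella 2018 Thm. A re-proved along the author's
erratum); a RESEARCH ROUTE; no claim beyond the stated class; X11b stays CONSTRUCTION-SHAPED;
nothing here changes a label; no named fact is minted (theorems only; no `sorry`); CONDITIONAL on
the cited facts `poitouTate_sha_tateDual K` (Harari 17.13 (b)) and `FieldCdLE K p 2`
(Serre II §4.4 Prop. 13, `fieldCdLE_two_of_numberField`), taken as hypotheses.

## What this file does (first half of JSW17 Lemma 3.3.3 at the level of `H²`)

**`subsingleton_galoisCohomology_two_primary : Subsingleton (H²(Γ_K, E[p^∞]))`** for an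
elliptic curve over a TOTALLY COMPLEX number field `K`, from: `E[p^∞]^{Γ_K} = 0`; the FINITENESS of
Castella's `Sel_𝔭^Σ(K, E[p^∞])` (clause one of the typed atom (P6) — no new input); a uniform
`p`-power exponent of `E(K_v)[p^∞]` at every finite `v`; the two cited facts. (The tree's
Poitou–Tate facts are existential, so no limit over the levels `E[p^k]` is taken through them.)
Proof: (1) every class is `ι_N z`, `z ∈ H²(K, E[p^N])`; (2) `z` is locally zero off a finite set of
finite places (`GlobalH2FiniteSupport`), and at those its image dies in `H²(K_v, E[p^{N+b}])` for
`b ≥` the local exponents (`LocalH2TransitionCd`); complex places carry no `H²`; so every class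
comes from some `Ш²(K, E[p^M])`; (3) `#Ш²(K, E[p^M]) ≤ #Sel_𝔭^Σ(K, E[p^∞])` uniformly
(`ShaTwoLevelBound`), whence `H²(Γ_K, E[p^∞])` is FINITE; (4) it is `p`-divisible
(`H³(Γ_K, E[p]) = 0`, `cd_p ≤ 2`);
(5) finite, `p`-primary and `p`-divisible ⟹ trivial. Consumer: engine (b) of `ProcyclicDescent`.

References: [JetchevSkinnerWan2017] Lemma 3.3.3 (arXiv:1512.06894 pp. 11–12); [Harari2020]
Thm. 17.13 (b); [SerreGaloisCohomology1997] II §4.4 Prop. 13; [MilneADT2006] I Lemma 4.8, Cor. 2.3.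
-/

noncomputable section

open scoped Classical

open CategoryTheory Field NumberField IsDedekindDomain
open Literature.NumberTheory.EllipticCurves
open Literature.NumberTheory.GaloisRepresentations
open Literature.NumberTheory.GaloisRepresentations.DiscreteGaloisModule
open Literature.NumberTheory.GaloisCohomology
open scoped ContRepresentation

-- `H²` needs `LocallyCompactSpace Γ`; compactness of absolute Galois groups as a local instance.
attribute [local instance] absoluteGaloisGroup_compactSpace

namespace Summit.BirchSwinnertonDyer.Rank1Residual.X11b.WeakLeopoldt

/-! ## §1. Generic: `H²` of a trivial group; naturality of localisation in degree `2` -/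

section Generic

variable {K : Type} [Field K] [NumberField K]
  {M M' : Type} [AddCommGroup M] [TopologicalSpace M] [DiscreteTopology M]
  [AddCommGroup M'] [TopologicalSpace M'] [DiscreteTopology M']
  {ρ : DiscreteGaloisModule K M} {ρ' : DiscreteGaloisModule K M'}

/-- **Naturality of localisation in degree `2` at a finite place**:
`loc_v (H²(f) c) = H²(f|_{Γ_{K_v}}) (loc_v c)` (both are the class of `f ∘ c ∘ (res × res)`).
[folklore] -/
theorem localization_inr_map_two (f : ρ.toContRepresentation →ⁱL ρ'.toContRepresentation)
    (v : HeightOneSpectrum (𝓞 K)) (x : galoisCohomology ρ 2) :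
    galoisCohomology.localization ρ' (Sum.inr v) 2 (galoisCohomology.map f 2 x) =
      galoisCohomology.map (f.restrictField (v.adicCompletion K)) 2
        (galoisCohomology.localization ρ (Sum.inr v) 2 x) := by
  obtain ⟨c, rfl⟩ := twoCocycleClass_surjective _ x
  change galoisCohomology.localization ρ' (Sum.inr v) 2
      (cohomologyMap (DiscreteGaloisModule.homOfIntertwining f) 2 (twoCocycleClass _ c)) =
    cohomologyMap (DiscreteGaloisModule.homOfIntertwining (f.restrictField (v.adicCompletion K))) 2
      (galoisCohomology.localization ρ (Sum.inr v) 2 (twoCocycleClass _ c))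
  rw [cohomologyMap_twoCocycleClass, H2Support.localization_two_twoCocycleClass,
    H2Support.localization_two_twoCocycleClass]
  refine Eq.trans ?_ (cohomologyMap_twoCocycleClass (DiscreteGaloisModule.homOfIntertwining
    (f.restrictField (v.adicCompletion K))) _).symm
  exact congrArg (twoCocycleClass _) (Subtype.ext (ContinuousMap.ext fun _ ↦ rfl))

omit [NumberField K] in
/-- `H²` of a topological group with one element vanishes: a `2`-cocycle `f` is the coboundary of
the constant cochain `f(1,1)`. [folklore] -/
theorem twoCocycleClass_eq_zero_of_subsingleton {G : Type} [Group G] [TopologicalSpace G]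
    [IsTopologicalGroup G] [LocallyCompactSpace G] [Subsingleton G] (X : TopRep.{0} ℤ G)
    (f : contTwoCocycles X) : twoCocycleClass X f = 0 := by
  rw [twoCocycleClass_eq_zero_iff]
  refine ⟨ContinuousMap.const G (f.1 (1, 1)), fun σ τ ↦ ?_⟩
  rw [Subsingleton.elim σ 1, Subsingleton.elim τ 1]
  simp

/-- At a complex place `w`, `H²(K_w, M) = 0` (`Γ_{K_w}` is trivial). [folklore] -/
theorem localization_inl_two_eq_zero {w : InfinitePlace K} (hw : w.IsComplex)
    (c : galoisCohomology ρ 2) : galoisCohomology.localization ρ (Sum.inl w) 2 c = 0 := by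
  haveI : IsAlgClosed w.Completion :=
    IsAlgClosed.of_ringEquiv ℂ w.Completion
      (InfinitePlace.Completion.ringEquivComplexOfIsComplex hw).symm
  haveI : Subsingleton (absoluteGaloisGroup (Place.Completion (Sum.inl w : Place K))) :=
    AcSelmer.subsingleton_absoluteGaloisGroup_of_isAlgClosed w.Completion
  obtain ⟨z, hz⟩ := twoCocycleClass_surjective _ (galoisCohomology.localization ρ (Sum.inl w) 2 c)
  rw [← hz]
  exact twoCocycleClass_eq_zero_of_subsingleton _ z

end Generic

/-! ## §2. Levels: every class of `H²(K, E[p^∞])` comes from some `Ш²(K, E[p^M])` -/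

section Levels

variable {K : Type} [Field K] [NumberField K] (W : WeierstrassCurve K) [W.IsElliptic]
  (p : ℕ) [Fact p.Prime]

omit [NumberField K] [W.IsElliptic] [Fact p.Prime] in
/-- **Every class of `H²(K, E[p^∞])` comes from some level `H²(K, E[p^N])`, `N ≥ 1`** (a continuous
`2`-cocycle on the compact `Γ_K × Γ_K` with values in the discrete `p`-primary `E[p^∞]` has a common
killing exponent and lifts through `E[p^N] ↪ E[p^∞]`; the global twin of gen 15's
`exists_map_two_primaryInclusion_eq`). [cite: GreenbergLNM1716, §3 Lemma 3.3 (p. 87)] -/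
theorem exists_map_two_primaryInclusion_eq_of_global
    (Z : galoisCohomology (LocBridge.primaryGaloisModule W p) 2) :
    ∃ N : ℕ, N ≠ 0 ∧ ∃ z : galoisCohomology (W.torsionGaloisModule ((p ^ N : ℕ) : ℤ)) 2,
      galoisCohomology.map (Levels.primaryInclusion W p N) 2 z = Z := by
  obtain ⟨c, rfl⟩ := twoCocycleClass_surjective _ Z
  have hB : ∀ Q : W.geomPrimaryTorsion p, ∃ k : ℕ, p ^ k • Q = 0 := fun Q ↦
    (AddCommGroup.mem_primaryComponent.mp Q.2).imp fun k hk ↦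
      Subtype.ext (by rw [AddSubmonoidClass.coe_nsmul, hk, ZeroMemClass.coe_zero])
  obtain ⟨N₀, hN₀⟩ := exists_pow_smul_apply_eq_zero c.1 fun στ ↦ hB (c.1 στ)
  have hN : ∀ στ, p ^ (N₀ + 1) • c.1 στ = 0 := fun στ ↦ by
    rw [pow_succ, mul_comm, mul_smul, hN₀, smul_zero]
  exact ⟨N₀ + 1, Nat.succ_ne_zero _, twoCocycleClass _ (Levels.liftTwoCocycle
      (Levels.primaryInclusion W p (N₀ + 1)) (p ^ (N₀ + 1))
      (Levels.exists_primaryInclusion_eq_of_nsmul_eq_zero W p (N₀ + 1))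
      (Levels.primaryInclusion_injective W p (N₀ + 1)) c hN),
    Levels.map_two_twoCocycleClass_liftTwoCocycle _ _ _ _ c hN⟩

omit [Fact p.Prime] in
/-- Change of level `E[p^N] ↪ E[p^M]` for `N ≤ M` (the tree's `torsionInclusion`). [folklore] -/
theorem pow_dvd_pow_cast {N M : ℕ} (h : N ≤ M) : ((p ^ N : ℕ) : ℤ) ∣ ((p ^ M : ℕ) : ℤ) :=
  Int.natCast_dvd_natCast.mpr (Nat.pow_dvd_pow p h)

omit [NumberField K] [W.IsElliptic] [Fact p.Prime] in
/-- `ι_M ∘ (E[p^N] ↪ E[p^M]) = ι_N` on `H²`. [folklore] -/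
theorem map_primaryInclusion_map_torsionInclusion {N M : ℕ} (h : N ≤ M)
    (z : galoisCohomology (W.torsionGaloisModule ((p ^ N : ℕ) : ℤ)) 2) :
    galoisCohomology.map (Levels.primaryInclusion W p M) 2
        (galoisCohomology.map (W.torsionInclusion (pow_dvd_pow_cast p h)) 2 z) =
      galoisCohomology.map (Levels.primaryInclusion W p N) 2 z :=
  Levels.map_two_map_two_eq_map_two (ρ₁ := W.torsionGaloisModule ((p ^ N : ℕ) : ℤ))
    (ρ₂ := W.torsionGaloisModule ((p ^ M : ℕ) : ℤ)) (ρ₃ := LocBridge.primaryGaloisModule W p)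
    _ _ _ (fun _ ↦ Subtype.ext rfl) z

omit [W.IsElliptic] [Fact p.Prime] in
/-- The change of level carries `Ш²` into `Ш²` for `K` totally complex (naturality of localisation
at the finite places; nothing at the complex ones). [folklore] -/
theorem map_torsionInclusion_mem_shaTwo [IsTotallyComplex K] {N M : ℕ} (h : N ≤ M)
    {z : galoisCohomology (W.torsionGaloisModule ((p ^ N : ℕ) : ℤ)) 2}
    (hz : z ∈ shaTwo (W.torsionGaloisModule ((p ^ N : ℕ) : ℤ))) :
    galoisCohomology.map (W.torsionInclusion (pow_dvd_pow_cast p h)) 2 z ∈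
      shaTwo (W.torsionGaloisModule ((p ^ M : ℕ) : ℤ)) := by
  rw [mem_shaTwo_iff] at hz ⊢
  rintro (w | v)
  · exact localization_inl_two_eq_zero (IsTotallyComplex.isComplex w) _
  · rw [localization_inr_map_two, hz (Sum.inr v)]
    exact map_zero _

/-- **Every class of `H²(K, E[p^∞])` comes from `Ш²(K, E[p^M])` for some `M ≥ 1`** (`K` totally
complex): lift to a level `N`; off a finite set `S` of finite places the lift is locally zero
(`eventually_localization_two_torsion_eq_zero`); pushing to level `N + b`, `b` beyond the local
`p`-power exponents of `E(K_v)`, `v ∈ S`, kills the remaining localisations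
(`map_two_torsionInclusion_eq_zero_of_exponent`); complex places carry no `H²`.
[cite: JetchevSkinnerWan2017, Lemma 3.3.3 (arXiv:1512.06894 p. 12)]
[cite: MilneADT2006, Ch. I §4, Lemma 4.8] -/
theorem exists_mem_shaTwo_map_eq [IsTotallyComplex K]
    (htor : ∀ v : HeightOneSpectrum (𝓞 K), ∃ e : ℕ,
      ∀ (j : ℕ) (Q : (W.baseChange (v.adicCompletion K)).toAffine.Point),
        p ^ j • Q = 0 → p ^ e • Q = 0)
    (Z : galoisCohomology (LocBridge.primaryGaloisModule W p) 2) :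
    ∃ M : ℕ, M ≠ 0 ∧ ∃ z : galoisCohomology (W.torsionGaloisModule ((p ^ M : ℕ) : ℤ)) 2,
      z ∈ shaTwo (W.torsionGaloisModule ((p ^ M : ℕ) : ℤ)) ∧
        galoisCohomology.map (Levels.primaryInclusion W p M) 2 z = Z := by
  obtain ⟨N, hN0, z, rfl⟩ := exists_map_two_primaryInclusion_eq_of_global W p Z
  -- the finite exceptional set and a common exponent
  have hS := H2Support.eventually_localization_two_torsion_eq_zero W p N z
  rw [Filter.eventually_cofinite] at hS
  choose e he using htor
  set b : ℕ := hS.toFinset.sup e + 1 with hb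
  have hbe : ∀ v ∈ hS.toFinset, e v ≤ b := fun v hv ↦
    (Finset.le_sup hv).trans (Nat.le_succ _)
  refine ⟨N + b, by omega, galoisCohomology.map (W.torsionInclusion
    (pow_dvd_pow_cast p (Nat.le_add_right N b))) 2 z, ?_,
    map_primaryInclusion_map_torsionInclusion W p (Nat.le_add_right N b) z⟩
  rw [mem_shaTwo_iff]
  rintro (w | v)
  · -- complex places
    exact localization_inl_two_eq_zero (IsTotallyComplex.isComplex w) _
  · -- finite places
    rw [localization_inr_map_two]
    by_cases hv : galoisCohomology.localization (W.torsionGaloisModule ((p ^ N : ℕ) : ℤ))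
        (Sum.inr v) 2 z = 0
    · rw [hv]; exact map_zero _
    · have hvS : v ∈ hS.toFinset := by simpa using hv
      -- factor `E[p^N] ↪ E[p^{N+b}]` through `E[p^N · p^b]` at `K_v`
      have hab : ((p ^ N : ℕ) : ℤ) * ((p ^ b : ℕ) : ℤ) ∣ ((p ^ (N + b) : ℕ) : ℤ) :=
        ⟨1, by rw [mul_one, ← Nat.cast_mul, ← pow_add]⟩
      haveI : CharZero (v.adicCompletion K) :=
        charZero_of_injective_algebraMap (algebraMap K (v.adicCompletion K)).injective
      have hfac := Levels.map_two_map_two_eq_map_two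
        (ρ₁ := GaloisRep.restrictField (v.adicCompletion K)
          (W.torsionGaloisModule ((p ^ N : ℕ) : ℤ)))
        (ρ₂ := GaloisRep.restrictField (v.adicCompletion K)
          (W.torsionGaloisModule (((p ^ N : ℕ) : ℤ) * ((p ^ b : ℕ) : ℤ))))
        (ρ₃ := GaloisRep.restrictField (v.adicCompletion K)
          (W.torsionGaloisModule ((p ^ (N + b) : ℕ) : ℤ)))
        ((W.torsionInclusion (Dvd.intro ((p ^ b : ℕ) : ℤ) rfl :
          ((p ^ N : ℕ) : ℤ) ∣ ((p ^ N : ℕ) : ℤ) * ((p ^ b : ℕ) : ℤ))).restrictField _)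
        ((W.torsionInclusion hab).restrictField _)
        ((W.torsionInclusion (pow_dvd_pow_cast p (Nat.le_add_right N b))).restrictField _)
        (fun _ ↦ Subtype.ext rfl)
        (galoisCohomology.localization (W.torsionGaloisModule ((p ^ N : ℕ) : ℤ)) (Sum.inr v) 2 z)
      rw [← hfac, Levels.map_two_torsionInclusion_eq_zero_of_exponent W p (v.adicCompletion K) hN0
        (by omega) (hbe v hvS) (he v)]
      exact map_zero _

end Levels

/-! ## §3. Finiteness, divisibility, vanishing -/

section Main

variable {K : Type} [Field K] [NumberField K] (W : WeierstrassCurve K) [W.IsElliptic]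
  (p : ℕ) [Fact p.Prime] (𝔭 : HeightOneSpectrum (𝓞 K)) (S : Set (HeightOneSpectrum (𝓞 K)))

/-- **`H²(Γ_K, E[p^∞])` is finite** (of order at most `#Sel_𝔭^Σ(K, E[p^∞])`): every finite set of
classes lifts to a single `Ш²(K, E[p^M])`, whose order is bounded by `ShaTwoLevelBound`.
[cite: JetchevSkinnerWan2017, Lemma 3.3.3 (arXiv:1512.06894 p. 12)]
[cite: Harari2020, Thm. 17.13 (b)] -/
theorem finite_galoisCohomology_two_primary [IsTotallyComplex K] (hPT : poitouTate_sha_tateDual K)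
    [Finite (AcSelmer.selmerAcBase W p 𝔭 S)]
    (hΓ : ∀ Q : W.geomPrimaryTorsion p,
      (∀ σ : absoluteGaloisGroup K, LocBridge.primaryGaloisModule W p σ Q = Q) → Q = 0)
    (htor : ∀ v : HeightOneSpectrum (𝓞 K), ∃ e : ℕ,
      ∀ (j : ℕ) (Q : (W.baseChange (v.adicCompletion K)).toAffine.Point),
        p ^ j • Q = 0 → p ^ e • Q = 0) :
    Finite (galoisCohomology (LocBridge.primaryGaloisModule W p) 2) := by
  have key : ∀ s : Finset (galoisCohomology (LocBridge.primaryGaloisModule W p) 2),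
      s.card ≤ Nat.card (AcSelmer.selmerAcBase W p 𝔭 S) := by
    intro s
    choose M hM0 z hzsha hz using fun Z : galoisCohomology (LocBridge.primaryGaloisModule W p) 2 ↦
      exists_mem_shaTwo_map_eq W p htor Z
    have hML : ∀ Z ∈ s, M Z ≤ s.sup M + 1 := fun Z hZ ↦ (Finset.le_sup hZ).trans (Nat.le_succ _)
    obtain ⟨hfinL, hcardL⟩ := ShaBound.natCard_shaTwo_torsion_le_selmerAcBase W p (s.sup M + 1) 𝔭
      hPT (Nat.succ_ne_zero _) S hΓ
    haveI := hfinL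
    haveI := Fintype.ofFinite (shaTwo (W.torsionGaloisModule ((p ^ (s.sup M + 1) : ℕ) : ℤ)))
    let g : shaTwo (W.torsionGaloisModule ((p ^ (s.sup M + 1) : ℕ) : ℤ)) →
        galoisCohomology (LocBridge.primaryGaloisModule W p) 2 :=
      fun y ↦ galoisCohomology.map (Levels.primaryInclusion W p (s.sup M + 1)) 2 y
    have hsub : s ⊆ Finset.univ.image g := by
      intro Z hZ
      rw [Finset.mem_image]
      refine ⟨⟨galoisCohomology.map (W.torsionInclusion (pow_dvd_pow_cast p (hML Z hZ))) 2 (z Z),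
        map_torsionInclusion_mem_shaTwo W p (hML Z hZ) (hzsha Z)⟩, Finset.mem_univ _, ?_⟩
      change galoisCohomology.map (Levels.primaryInclusion W p (s.sup M + 1)) 2
        (galoisCohomology.map (W.torsionInclusion (pow_dvd_pow_cast p (hML Z hZ))) 2 (z Z)) = Z
      rw [map_primaryInclusion_map_torsionInclusion W p (hML Z hZ), hz]
    calc s.card ≤ (Finset.univ.image g).card := Finset.card_le_card hsub
      _ ≤ Finset.univ.card := Finset.card_image_le
      _ = Nat.card (shaTwo (W.torsionGaloisModule ((p ^ (s.sup M + 1) : ℕ) : ℤ))) := by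
          rw [Finset.card_univ, Nat.card_eq_fintype_card]
      _ ≤ Nat.card (AcSelmer.selmerAcBase W p 𝔭 S) := hcardL
  by_contra hinf
  rw [not_finite_iff_infinite] at hinf
  obtain ⟨t, -, ht⟩ :=
    (Set.infinite_univ (α := galoisCohomology (LocBridge.primaryGaloisModule W p) 2)
    ).exists_subset_card_eq (Nat.card (AcSelmer.selmerAcBase W p 𝔭 S) + 1)
  have := key t
  omega

omit [W.IsElliptic] in
/-- **`H²(Γ_K, E[p^∞])` is `p`-divisible** when `cd_p(Γ_K) ≤ 2`: along
`0 → E[p] → E[p·p^N] →[p] E[p^N] → 0`, `H²(K, E[p·p^N]) → H²(K, E[p^N])` is onto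
(`H³(Γ_K, E[p]) = 0`), and `ι_N ∘ [p] = p · ι_{1+N}` on points.
[cite: SerreGaloisCohomology1997, II §4.4 Prop. 13]
[cite: JetchevSkinnerWan2017, Lemma 3.3.3 (arXiv:1512.06894 p. 12)] -/
theorem exists_smul_eq (hcd : FieldCdLE K p 2)
    (Z : galoisCohomology (LocBridge.primaryGaloisModule W p) 2) :
    ∃ Y : galoisCohomology (LocBridge.primaryGaloisModule W p) 2, p • Y = Z := by
  have hprime : p.Prime := Fact.out
  obtain ⟨N, -, z, rfl⟩ := exists_map_two_primaryInclusion_eq_of_global W p Z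
  -- the short exact sequence `0 → E[p] → E[p · p^N] →[p] E[p^N] → 0`
  have hp0 : ((p ^ 1 : ℕ) : ℤ) ≠ 0 := by exact_mod_cast pow_ne_zero 1 hprime.ne_zero
  have hses := W.torsion_isSES hp0 ((p ^ N : ℕ) : ℤ)
  -- `H³(Γ_K, E[p]) = 0`
  haveI : Subsingleton (continuousCohomology 3
      (W.torsionGaloisModule ((p ^ 1 : ℕ) : ℤ)).toTopRep) :=
    hcd _ (W.torsionGaloisModule ((p ^ 1 : ℕ) : ℤ))
      (fun T ↦ ⟨1, Subtype.ext (by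
        have hT := (W.mem_geomTorsion_iff _ _).mp T.2
        rw [AddSubmonoidClass.coe_nsmul, ZeroMemClass.coe_zero, ← natCast_zsmul]
        exact hT)⟩)
      (by norm_num)
  obtain ⟨d, rfl⟩ := hses.exists_map_two_eq_of_subsingleton_three z
  -- `Y = ι_{1+N} (incl d)`
  have hdiv : ((p ^ 1 : ℕ) : ℤ) * ((p ^ N : ℕ) : ℤ) ∣ ((p ^ (1 + N) : ℕ) : ℤ) :=
    ⟨1, by rw [mul_one, ← Nat.cast_mul, ← pow_add]⟩
  refine ⟨galoisCohomology.map (Levels.primaryInclusion W p (1 + N)) 2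
    (galoisCohomology.map (W.torsionInclusion hdiv) 2 d), ?_⟩
  obtain ⟨δ, rfl⟩ := twoCocycleClass_surjective _ d
  change p • cohomologyMap
      (DiscreteGaloisModule.homOfIntertwining (Levels.primaryInclusion W p (1 + N))) 2
      (cohomologyMap (DiscreteGaloisModule.homOfIntertwining (W.torsionInclusion hdiv)) 2
        (twoCocycleClass _ δ)) =
    cohomologyMap (DiscreteGaloisModule.homOfIntertwining (Levels.primaryInclusion W p N)) 2
      (cohomologyMap (DiscreteGaloisModule.homOfIntertwining (W.torsionMulBy _ _)) 2
        (twoCocycleClass _ δ))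
  rw [cohomologyMap_twoCocycleClass, cohomologyMap_twoCocycleClass, cohomologyMap_twoCocycleClass,
    cohomologyMap_twoCocycleClass, ← Nat.cast_smul_eq_nsmul ℤ, ← twoCocycleClass_smul]
  congr 1
  refine Subtype.ext (ContinuousMap.ext fun στ ↦ Subtype.ext ?_)
  change ((p : ℤ) • (Levels.primaryInclusion W p (1 + N) (W.torsionInclusion hdiv (δ.1 στ)) :
      W.geomPrimaryTorsion p) : W.geomPoints) =
    ((Levels.primaryInclusion W p N (W.torsionMulBy _ _ (δ.1 στ)) : W.geomPrimaryTorsion p) :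
      W.geomPoints)
  rw [Levels.coe_primaryInclusion_apply, Levels.coe_primaryInclusion_apply,
    WeierstrassCurve.coe_torsionInclusion_apply, WeierstrassCurve.coe_torsionMulBy_apply]
  congr 1
  rw [pow_one]

omit [NumberField K] [W.IsElliptic] [Fact p.Prime] in
/-- Every class of `H²(K, E[p^∞])` is killed by a power of `p`. [folklore] -/
theorem exists_pow_smul_eq_zero (Z : galoisCohomology (LocBridge.primaryGaloisModule W p) 2) :
    ∃ n : ℕ, p ^ n • Z = 0 := by
  obtain ⟨N, -, z, rfl⟩ := exists_map_two_primaryInclusion_eq_of_global W p Z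
  refine ⟨N, ?_⟩
  rw [← map_nsmul]
  obtain ⟨δ, rfl⟩ := twoCocycleClass_surjective _ z
  have hδ : ((p ^ N : ℕ) : ℤ) • δ = 0 := Subtype.ext (ContinuousMap.ext fun στ ↦ by
    change ((p ^ N : ℕ) : ℤ) • δ.1 στ = 0
    exact Subtype.ext (by
      rw [natCast_zsmul, AddSubmonoidClass.coe_nsmul, ZeroMemClass.coe_zero, ← natCast_zsmul]
      exact (W.mem_geomTorsion_iff _ _).mp (δ.1 στ).2))
  have h0 : p ^ N • twoCocycleClass (W.torsionGaloisModule ((p ^ N : ℕ) : ℤ)).toTopRep δ = 0 := by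
    rw [← Nat.cast_smul_eq_nsmul ℤ, ← twoCocycleClass_smul, hδ, twoCocycleClass_zero]
  exact (congrArg (galoisCohomology.map (Levels.primaryInclusion W p N) 2) h0).trans (map_zero _)

/-- **WEAK LEOPOLDT for `E[p^∞]` over a totally complex number field: `H²(Γ_K, E[p^∞]) = 0`**,
from the finiteness of Castella's Selmer group `Sel_𝔭^Σ(K, E[p^∞])` (clause one of atom (P6)),
`E[p^∞]^{Γ_K} = 0`, uniform `p`-power exponents of `E(K_v)[p^∞]` at the finite places, and the
cited facts `poitouTate_sha_tateDual K`, `FieldCdLE K p 2`. Finite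
(`finite_galoisCohomology_two_primary`), `p`-primary and `p`-divisible (`exists_smul_eq`), hence
trivial. This is the input of JSW17 Lemma 3.3.3's injection `H¹(K, M)_Γ ↪ H²(K, W)` in route R1's
`K_∞`-formulation (`ProcyclicDescent.exists_conjH1_sub_eq_of_subsingleton`).
[cite: JetchevSkinnerWan2017, Lemma 3.3.3 (arXiv:1512.06894 pp. 11–12)]
[cite: Harari2020, Thm. 17.13 (b)] [cite: SerreGaloisCohomology1997, II §4.4 Prop. 13] -/
theorem subsingleton_galoisCohomology_two_primary [IsTotallyComplex K]
    (hPT : poitouTate_sha_tateDual K) (hcd : FieldCdLE K p 2)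
    [Finite (AcSelmer.selmerAcBase W p 𝔭 S)]
    (hΓ : ∀ Q : W.geomPrimaryTorsion p,
      (∀ σ : absoluteGaloisGroup K, LocBridge.primaryGaloisModule W p σ Q = Q) → Q = 0)
    (htor : ∀ v : HeightOneSpectrum (𝓞 K), ∃ e : ℕ,
      ∀ (j : ℕ) (Q : (W.baseChange (v.adicCompletion K)).toAffine.Point),
        p ^ j • Q = 0 → p ^ e • Q = 0) :
    Subsingleton (galoisCohomology (LocBridge.primaryGaloisModule W p) 2) := by
  haveI := finite_galoisCohomology_two_primary W p 𝔭 S hPT hΓ htor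
  choose n hn using exists_pow_smul_eq_zero W p
  haveI := Fintype.ofFinite (galoisCohomology (LocBridge.primaryGaloisModule W p) 2)
  have hexp : ∀ Z : galoisCohomology (LocBridge.primaryGaloisModule W p) 2,
      p ^ (Finset.univ.sup n) • Z = 0 := fun Z ↦ by
    have hle : n Z ≤ Finset.univ.sup n := Finset.le_sup (Finset.mem_univ Z)
    rw [← Nat.sub_add_cancel hle, pow_add, mul_smul, hn, smul_zero]
  have hiter : ∀ (m : ℕ) (Z : galoisCohomology (LocBridge.primaryGaloisModule W p) 2),
      ∃ Y : galoisCohomology (LocBridge.primaryGaloisModule W p) 2, p ^ m • Y = Z := by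
    intro m
    induction m with
    | zero => exact fun Z ↦ ⟨Z, by rw [pow_zero, one_smul]⟩
    | succ m ih =>
      intro Z
      obtain ⟨Y, rfl⟩ := ih Z
      obtain ⟨Y', rfl⟩ := exists_smul_eq W p hcd Y
      exact ⟨Y', by rw [pow_succ, mul_smul]⟩
  refine ⟨fun Z Z' ↦ ?_⟩
  obtain ⟨Y, rfl⟩ := hiter (Finset.univ.sup n) Z
  obtain ⟨Y', rfl⟩ := hiter (Finset.univ.sup n) Z'
  rw [hexp, hexp]

end Main

end Summit.BirchSwinnertonDyer.Rank1Residual.X11b.WeakLeopoldt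

end
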